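import Summits.AtomisticToContinuum.FouriersLaw.Theorems.PhononMeanFreePathDefs
import Summits.AtomisticToContinuum.FouriersLaw.Theorems.IncoherentChannel.Negative.UnitTemperature

/-!
# Amplitude scaling of the line objects: both open stubs of `two-horizons-forecast-loss` are their `T = 1` slices (negative-side support)

Support lemmas for crux `PhononMeanFreePath.IncoherentChannel` (item stmt-AtomisticToContinuum-11811)
from the standing disprover's work file `Cruxes/IncoherentChannel/Disproof.lean` §6 (gen 3), all
sorry-free, no new definitions. The kernel-level conjugacy `(q,p) ↦ (sq,sp)`,
`(lam, β, T) ↦ (lam s², β s², T/s²)` of `Negative/UnitTemperature` pushed through the route vocabulary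
`PhononMeanFreePathDefs` of the line: `v_t ↦ s·v_t` (`fcast_smul`), `S_N ↦ s²S_N` (`fnorm_smul`),
`r_N ↦ s²r_N` (`pairCorr_smul`), `C_N, P_N, B_N ↦ s⁴·(…)` (`powerCov_smul`, `commonPast_smul`,
`varianceChannel_smul`), and the transport sequence `N(γ²/T²)∫₀^∞B_N` is INVARIANT (`varianceSeq_smul`).
Hence `S_N(t; lam,β,T) = T·S_N(t; lam·T,β·T,1)` (`fnorm_eq_effective`) and both OPEN stubs of the line
— the engine `stub_forecastLoss` (`∃ C α > 2, S_N(t) ≤ C(1+t)^{-α}`) and the transport core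
`stub_varianceLimit` (`∃ κ > 0, N(γ²/T²)∫B_N → κ`) — are equivalent to their unit-temperature slices
(`forecastLoss_iff_unit_temperature`, `varianceLimit_iff_unit_temperature`): the constants `C, α, κ`
are functions of `(ω₂, lam·T, β·T, γ)` only, and `T → 0⁺` at fixed `(lam, β)` is the harmonic corner
where both stubs fail (`forecastLossEnvelope_false_harmonic`, `varianceLimit_false_harmonic`), so
nothing uniform in `T` can be proved.
-/

noncomputable section

open MeasureTheory Filter Topology Set
open scoped NNReal
open Literature.MathematicalPhysics.KineticTheory.HeatConduction
open Literature.Probability.Process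
open Summit.AtomisticToContinuum.FouriersLaw.Theorems.PhononMeanFreePath
open Summit.AtomisticToContinuum.FouriersLaw.Theorems.IncoherentChannel.Negative.UnitTemperature
  (integral_transitionKernel_smul integral_gibbsMeasure_smul rN_smul CN_smul)

namespace Summit.AtomisticToContinuum.FouriersLaw.Theorems.IncoherentChannel.Negative.LineScaling

section LineScaling

variable {ω₂ lam β γ : ℝ} (hω : 0 < ω₂) (hl : 0 ≤ lam) (hβ : 0 ≤ β) (hγ : 0 ≤ γ)
include hω hl hβ hγ

/-- The mean forecast is an amplitude: `v_t(s•x; lam,β,s²T) = s · v_t(x; lam s²,β s²,T)`. [folklore] -/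
theorem fcast_smul {s : ℝ} (hs : 0 < s) (T : ℝ) (N : ℕ) (t : ℝ) (x : PhaseSpace (N + 1)) :
    fcast ω₂ lam β γ (s ^ 2 * T) N t (s • x) = s * fcast ω₂ (lam * s ^ 2) (β * s ^ 2) γ T N t x := by
  unfold fcast
  rw [integral_transitionKernel_smul hω hl hβ hγ (N + 1) hs T T _ x]
  simp only [Prod.smul_snd, Pi.smul_apply, smul_eq_mul]
  exact integral_const_mul s _

/-- The forecast norm is an energy: `S_N(t; lam,β,s²T) = s² · S_N(t; lam s²,β s²,T)`. [folklore] -/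
theorem fnorm_smul {s : ℝ} (hs : 0 < s) (T : ℝ) (N : ℕ) (t : ℝ) :
    fnorm ω₂ lam β γ (s ^ 2 * T) N t = s ^ 2 * fnorm ω₂ (lam * s ^ 2) (β * s ^ 2) γ T N t := by
  unfold fnorm
  rw [integral_gibbsMeasure_smul (N + 1) hs.ne' T, ← integral_const_mul]
  refine integral_congr_ae (Eventually.of_forall fun x => ?_)
  simp only []
  rw [fcast_smul hω hl hβ hγ hs]
  ring

/-- `r_N ↦ s² r_N` (over the route vocabulary). [folklore] -/
theorem pairCorr_smul {s : ℝ} (hs : 0 < s) (T : ℝ) (N : ℕ) (t : ℝ) :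
    pairCorr ω₂ lam β γ (s ^ 2 * T) N t = s ^ 2 * pairCorr ω₂ (lam * s ^ 2) (β * s ^ 2) γ T N t := by
  simp only [pairCorr, fcast]
  exact rN_smul hω hl hβ hγ hs T N t

/-- `C_N ↦ s⁴ C_N` (over the route vocabulary). [folklore] -/
theorem powerCov_smul {s : ℝ} (hs : 0 < s) (T : ℝ) (N : ℕ) (t : ℝ) :
    powerCov ω₂ lam β γ (s ^ 2 * T) N t = s ^ 4 * powerCov ω₂ (lam * s ^ 2) (β * s ^ 2) γ T N t := by
  simp only [powerCov]
  exact CN_smul hω hl hβ hγ hs T N t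

/-- `P_N ↦ s⁴ P_N`. [folklore] -/
theorem commonPast_smul {s : ℝ} (hs : 0 < s) (T : ℝ) (N : ℕ) (t : ℝ) :
    commonPast ω₂ lam β γ (s ^ 2 * T) N t = s ^ 4 * commonPast ω₂ (lam * s ^ 2) (β * s ^ 2) γ T N t := by
  unfold commonPast
  rw [integral_gibbsMeasure_smul (N + 1) hs.ne' T, integral_gibbsMeasure_smul (N + 1) hs.ne' T,
    integral_gibbsMeasure_smul (N + 1) hs.ne' T]
  simp_rw [fcast_smul hω hl hβ hγ hs]
  simp only [Prod.smul_snd, Pi.smul_apply, smul_eq_mul]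
  have e1 : (fun x : PhaseSpace (N + 1) => (s * x.2 0) ^ 2 * (s * fcast ω₂ (lam * s ^ 2) (β * s ^ 2) γ T N t x) ^ 2) =
      fun x => s ^ 4 * (x.2 0 ^ 2 * fcast ω₂ (lam * s ^ 2) (β * s ^ 2) γ T N t x ^ 2) := funext fun x => by ring
  have e2 : (fun x : PhaseSpace (N + 1) => (s * x.2 0) ^ 2) = fun x => s ^ 2 * x.2 0 ^ 2 :=
    funext fun x => by ring
  have e3 : (fun x : PhaseSpace (N + 1) => (s * fcast ω₂ (lam * s ^ 2) (β * s ^ 2) γ T N t x) ^ 2) =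
      fun x => s ^ 2 * fcast ω₂ (lam * s ^ 2) (β * s ^ 2) γ T N t x ^ 2 := funext fun x => by ring
  rw [e1, e2, e3, integral_const_mul, integral_const_mul, integral_const_mul]
  ring

/-- `B_N ↦ s⁴ B_N`. [folklore] -/
theorem varianceChannel_smul {s : ℝ} (hs : 0 < s) (T : ℝ) (N : ℕ) (t : ℝ) :
    varianceChannel ω₂ lam β γ (s ^ 2 * T) N t =
      s ^ 4 * varianceChannel ω₂ (lam * s ^ 2) (β * s ^ 2) γ T N t := by
  unfold varianceChannel
  rw [powerCov_smul hω hl hβ hγ hs, commonPast_smul hω hl hβ hγ hs]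
  ring

/-- **The transport sequence of `stub_varianceLimit` is scale-INVARIANT** (the prefactor `γ²/T²`
absorbs the `s⁴`). [folklore] -/
theorem varianceSeq_smul {s : ℝ} (hs : 0 < s) (T : ℝ) (N : ℕ) :
    (N : ℝ) * (γ ^ 2 / (s ^ 2 * T) ^ 2) * ∫ t in Ioi (0 : ℝ), varianceChannel ω₂ lam β γ (s ^ 2 * T) N t =
      (N : ℝ) * (γ ^ 2 / T ^ 2) * ∫ t in Ioi (0 : ℝ), varianceChannel ω₂ (lam * s ^ 2) (β * s ^ 2) γ T N t := by
  simp_rw [varianceChannel_smul hω hl hβ hγ hs T N]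
  rw [integral_const_mul]
  have hs4 : s ^ 4 ≠ 0 := pow_ne_zero 4 hs.ne'
  rw [show (s ^ 2 * T) ^ 2 = s ^ 4 * T ^ 2 by ring, div_mul_eq_div_div_swap]
  rw [show (N : ℝ) * (γ ^ 2 / T ^ 2 / s ^ 4) * (s ^ 4 * ∫ t in Ioi (0 : ℝ), varianceChannel ω₂ (lam * s ^ 2) (β * s ^ 2) γ T N t) =
      (N : ℝ) * (γ ^ 2 / T ^ 2 / s ^ 4 * s ^ 4) * ∫ t in Ioi (0 : ℝ), varianceChannel ω₂ (lam * s ^ 2) (β * s ^ 2) γ T N t by ring,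
    div_mul_cancel₀ _ hs4]

/-- **Temperature enters the forecast norm only through the effective couplings**:
`S_N(t; lam,β,T) = T · S_N(t; lam·T, β·T, 1)` (`T > 0`). [folklore] -/
theorem fnorm_eq_effective {T : ℝ} (hT : 0 < T) (N : ℕ) (t : ℝ) :
    fnorm ω₂ lam β γ T N t = T * fnorm ω₂ (lam * T) (β * T) γ 1 N t := by
  have hs : 0 < Real.sqrt T := Real.sqrt_pos.2 hT
  have hT' : Real.sqrt T ^ 2 = T := Real.sq_sqrt hT.le
  have h := fnorm_smul (ω₂ := ω₂) (lam := lam) (β := β) (γ := γ) hω hl hβ hγ hs 1 N t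
  rwa [mul_one, hT'] at h

/-- The transport sequence depends on `(lam·T, β·T)` only. [folklore] -/
theorem varianceSeq_eq_effective {T : ℝ} (hT : 0 < T) (N : ℕ) :
    (N : ℝ) * (γ ^ 2 / T ^ 2) * ∫ t in Ioi (0 : ℝ), varianceChannel ω₂ lam β γ T N t =
      (N : ℝ) * (γ ^ 2 / (1 : ℝ) ^ 2) * ∫ t in Ioi (0 : ℝ), varianceChannel ω₂ (lam * T) (β * T) γ 1 N t := by
  have hs : 0 < Real.sqrt T := Real.sqrt_pos.2 hT
  have hT' : Real.sqrt T ^ 2 = T := Real.sq_sqrt hT.le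
  have h := varianceSeq_smul (ω₂ := ω₂) (lam := lam) (β := β) (γ := γ) hω hl hβ hγ hs 1 N
  rwa [mul_one, hT'] at h

/-- **The envelope at `T` is the envelope at unit temperature with effective couplings**
(`C ↦ C/T`). [folklore] -/
theorem forecastEnvelopeAt_iff_effective {T : ℝ} (hT : 0 < T) :
    (∃ C α : ℝ, 2 < α ∧ ∀ (N : ℕ) (t : ℝ), 0 ≤ t → fnorm ω₂ lam β γ T N t ≤ C * (1 + t) ^ (-α)) ↔
      ∃ C α : ℝ, 2 < α ∧ ∀ (N : ℕ) (t : ℝ), 0 ≤ t →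
        fnorm ω₂ (lam * T) (β * T) γ 1 N t ≤ C * (1 + t) ^ (-α) := by
  constructor
  · rintro ⟨C, α, hα, h⟩
    refine ⟨C / T, α, hα, fun N t ht => ?_⟩
    have h1 := h N t ht
    rw [fnorm_eq_effective hω hl hβ hγ hT] at h1
    rw [div_mul_eq_mul_div, le_div_iff₀ hT]
    linarith
  · rintro ⟨C, α, hα, h⟩
    refine ⟨T * C, α, hα, fun N t ht => ?_⟩
    rw [fnorm_eq_effective hω hl hβ hγ hT, mul_assoc]
    exact mul_le_mul_of_nonneg_left (h N t ht) hT.le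

/-- **The transport limit at `T` is the transport limit at unit temperature with effective couplings**
(same `κ`). [folklore] -/
theorem varianceLimitAt_iff_effective {T : ℝ} (hT : 0 < T) :
    (∃ κ : ℝ, 0 < κ ∧ Tendsto (fun N : ℕ => (N : ℝ) * (γ ^ 2 / T ^ 2) *
        ∫ t in Ioi (0 : ℝ), varianceChannel ω₂ lam β γ T N t) atTop (𝓝 κ)) ↔
      ∃ κ : ℝ, 0 < κ ∧ Tendsto (fun N : ℕ => (N : ℝ) * (γ ^ 2 / (1 : ℝ) ^ 2) *
        ∫ t in Ioi (0 : ℝ), varianceChannel ω₂ (lam * T) (β * T) γ 1 N t) atTop (𝓝 κ) := by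
  rw [show (fun N : ℕ => (N : ℝ) * (γ ^ 2 / T ^ 2) * ∫ t in Ioi (0 : ℝ), varianceChannel ω₂ lam β γ T N t) =
      fun N : ℕ => (N : ℝ) * (γ ^ 2 / (1 : ℝ) ^ 2) * ∫ t in Ioi (0 : ℝ), varianceChannel ω₂ (lam * T) (β * T) γ 1 N t
    from funext (varianceSeq_eq_effective hω hl hβ hγ hT)]

end LineScaling

/-- **`stub_forecastLoss` is equivalent to its `T = 1` slice.** [folklore] -/
theorem forecastLoss_iff_unit_temperature :
    (∀ ω₂ lam β γ : ℝ, 0 < ω₂ → 0 < lam → 0 < β → 0 < γ → ∀ T : ℝ, 0 < T →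
      ∃ C α : ℝ, 2 < α ∧ ∀ (N : ℕ) (t : ℝ), 0 ≤ t → fnorm ω₂ lam β γ T N t ≤ C * (1 + t) ^ (-α)) ↔
      ∀ ω₂ lam β γ : ℝ, 0 < ω₂ → 0 < lam → 0 < β → 0 < γ →
        ∃ C α : ℝ, 2 < α ∧ ∀ (N : ℕ) (t : ℝ), 0 ≤ t → fnorm ω₂ lam β γ 1 N t ≤ C * (1 + t) ^ (-α) := by
  constructor
  · intro h ω₂ lam β γ hω hl hβ hγ
    exact h ω₂ lam β γ hω hl hβ hγ 1 one_pos
  · intro h ω₂ lam β γ hω hl hβ hγ T hT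
    rw [forecastEnvelopeAt_iff_effective hω hl.le hβ.le hγ.le hT]
    exact h ω₂ (lam * T) (β * T) γ hω (by positivity) (by positivity) hγ

/-- **`stub_varianceLimit` is equivalent to its `T = 1` slice.** [folklore] -/
theorem varianceLimit_iff_unit_temperature :
    (∀ ω₂ lam β γ : ℝ, 0 < ω₂ → 0 < lam → 0 < β → 0 < γ → ∀ T : ℝ, 0 < T →
      ∃ κ : ℝ, 0 < κ ∧ Tendsto (fun N : ℕ => (N : ℝ) * (γ ^ 2 / T ^ 2) *
        ∫ t in Ioi (0 : ℝ), varianceChannel ω₂ lam β γ T N t) atTop (𝓝 κ)) ↔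
      ∀ ω₂ lam β γ : ℝ, 0 < ω₂ → 0 < lam → 0 < β → 0 < γ →
        ∃ κ : ℝ, 0 < κ ∧ Tendsto (fun N : ℕ => (N : ℝ) * (γ ^ 2 / (1 : ℝ) ^ 2) *
          ∫ t in Ioi (0 : ℝ), varianceChannel ω₂ lam β γ 1 N t) atTop (𝓝 κ) := by
  constructor
  · intro h ω₂ lam β γ hω hl hβ hγ
    exact h ω₂ lam β γ hω hl hβ hγ 1 one_pos
  · intro h ω₂ lam β γ hω hl hβ hγ T hT
    rw [varianceLimitAt_iff_effective hω hl.le hβ.le hγ.le hT]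
    exact h ω₂ (lam * T) (β * T) γ hω (by positivity) (by positivity) hγ

end Summit.AtomisticToContinuum.FouriersLaw.Theorems.IncoherentChannel.Negative.LineScaling

end
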